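import Mathlib
import Literature.AlgebraicGeometry.Resolution.LocalBlowup
import Literature.AlgebraicGeometry.Resolution.TranscendenceDefect
import Literature.AlgebraicGeometry.Resolution.QuadraticTransformsRegular
import HarnessLib

/-!
# Lens 5 — PRankTwo currency: the three-slice currency and exit lemma

T-port from `Cruxes/DescentPerfectToAll/Census_lens5_pRankTwo.lean` rev 8.
Original author: res-B-lens-5.  OURS; nothing here proves resolution in characteristic `p`.

The currency definitions for THEOREM T (class (B)/(C) at `[Γ:pΓ] = p²`) and the exit lemma.

## Contents
* `CleanLUConcl` — the common conclusion of `stub_cleanLU3*`: a finitely generated `A ≤ A' ⊆ O`, regular at the centre of `O`,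
  carrying a non-trivial representative in loose clean form (1) ∨ (2) ∨ (3).
* `PRankTwoAt p O` — hypothesis (P2): `[Γ:pΓ] = p²`.
* `CleanLU3DefectPRankTwoAt p` — THEOREM T's slice: perfect `k`, `PRankTwoAt p O`.
* `cleanLUConcl_of_parameter` — the exit lemma: a regular parameter `ψ ∈ M ∖ K^p` gives form (3).
-/

noncomputable section

set_option linter.dupNamespace false

open IsLocalRing
open Literature.AlgebraicGeometry.Resolution

namespace Summit.ResolutionOfSingularities.ResolutionOfSingularities.Theorems.RadicialJung.CleanModels.Lens5.PRankTwoCurrency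

/-! ## §1 Currency -/

/-- **The common conclusion of `stub_cleanLU3*`**: a finitely generated `A ≤ A' ⊆ O`, regular at the centre of `O`, carrying a
non-trivial representative `Σ c_j^p g₀^j` of the `K^p`-line of `g₀` in loose clean form (1) ∨ (2) ∨ (3). [folklore] -/
def CleanLUConcl (p : ℕ) (k K : Type) [Field k] [Field K] [Algebra k K] (O : ValuationSubring K) (A : Subalgebra k K)
    (g₀ : K) : Prop :=
    ∃ (A' : Subalgebra k K), A'.toSubring ≤ O.toSubring ∧ A ≤ A' ∧ A'.FG ∧
      ∃ (_ : IsRegularLocalRing (locAtCentre A'.toSubring O)) (c : Fin p → K),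
        (∃ j : Fin p, (j : ℕ) ≠ 0 ∧ c j ≠ 0) ∧
        ((∃ (d m : ℕ) (hmd : m ≤ d) (t : Fin d → ↥(locAtCentre A'.toSubring O)) (a : Fin m → ℕ)
            (u : ↥(locAtCentre A'.toSubring O)), IsUnit u ∧
            Ideal.span (Set.range t) = IsLocalRing.maximalIdeal ↥(locAtCentre A'.toSubring O) ∧
            ringKrullDim ↥(locAtCentre A'.toSubring O) = (d : WithBot ℕ∞) ∧ 0 < m ∧ (∀ i, ¬ p ∣ a i) ∧
            (∑ j : Fin p, c j ^ p * g₀ ^ (j : ℕ)) =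
              (u : K) * ∏ i : Fin m, ((t (Fin.castLE hmd i) : ↥(locAtCentre A'.toSubring O)) : K) ^ (a i)) ∨
          (∃ u : ↥(locAtCentre A'.toSubring O), IsUnit u ∧ (∑ j : Fin p, c j ^ p * g₀ ^ (j : ℕ)) = (u : K) ∧
            ∀ c' : ↥(locAtCentre A'.toSubring O), u - c' ^ p ∉ IsLocalRing.maximalIdeal ↥(locAtCentre A'.toSubring O)) ∨
          (∃ s c' : ↥(locAtCentre A'.toSubring O), (∑ j : Fin p, c j ^ p * g₀ ^ (j : ℕ)) = (s : K) ∧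
            s - c' ^ p ∈ IsLocalRing.maximalIdeal ↥(locAtCentre A'.toSubring O) ∧
            s - c' ^ p ∉ IsLocalRing.maximalIdeal ↥(locAtCentre A'.toSubring O) ^ 2))

/-! ## §2 Hypothesis (P2) and THEOREM T's slice -/

/-- **(P2) `[Γ : pΓ] = p²`**: there are `x, y ∈ K^×` such that no non-trivial monomial `x^a y^b` (`0 ≤ a, b < p`, not both `0`) has
the value of a `p`-th power.  Equivalently the `𝔽_p`-space `Γ/pΓ` has dimension `2`. [folklore] -/
def PRankTwoAt {K : Type} [Field K] (p : ℕ) (O : ValuationSubring K) : Prop :=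
    ∃ x y : K, x ≠ 0 ∧ y ≠ 0 ∧ ∀ a b : ℕ, a < p → b < p → (a ≠ 0 ∨ b ≠ 0) →
      ∀ z : K, z ≠ 0 → O.valuation (x ^ a * y ^ b) ≠ O.valuation (z ^ p)

/-- **THEOREM T's slice** — `stub_cleanLU3DefectNonDiscrete` at `p` restricted to PERFECT ground fields and valuations with
`[Γ : pΓ] = p²`.  CLAIMED TRUE for every prime `p` by the hand proof of `CLASSBC-prank2-toric-lens5-g9.md`. [folklore] -/
def CleanLU3DefectPRankTwoAt (p : ℕ) : Prop :=
    ∀ (k : Type) [Field k] [CharP k p] [PerfectField k] (K : Type) [Field K] [Algebra k K]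
    (O : ValuationSubring K) (A : Subalgebra k K), A.toSubring ≤ O.toSubring → A.FG → IsFractionRing A K →
    ringKrullDim A ≤ 3 → IsRegularLocalRing (locAtCentre A.toSubring O) →
    ringKrullDim (locAtCentre A.toSubring O) = 3 →
    (∀ (T : Subring K) (hT : T ≤ O.toSubring), A.toSubring ≤ T → (subringCentre T O hT).IsMaximal) →
    ∀ g₀ : K, (∀ c : K, c ^ p ≠ g₀) →
    (∀ f₀ : K, ∃ f₁ : K, O.valuation (g₀ - f₁ ^ p) < O.valuation (g₀ - f₀ ^ p)) →
    (∀ hk : ∀ c : k, algebraMap k K c ∈ O, transcendenceDefect k O hk ≠ 0) →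
    ¬ (∃ π : K, π ≠ 0 ∧ (∀ x : K, O.valuation x < 1 → O.valuation x ≤ O.valuation π) ∧
      (∀ x : K, x ≠ 0 → ∃ n : ℕ, O.valuation π ^ n ≤ O.valuation x)) →
    PRankTwoAt p O →
    CleanLUConcl p k K O A g₀

/-! ## §3 Exit lemma helpers -/

/-- **An element of `𝔪 ∖ 𝔪²` of a local domain integrally closed in `K` is no `p`-th power in `K`.** [folklore] -/
theorem pow_ne_of_mem_maximalIdeal_of_not_mem_sq' {K : Type} [Field K] (S : Subring K) [IsLocalRing S]
    (hic : ∀ w : K, IsIntegral S w → w ∈ S) {p : ℕ} (hp : 2 ≤ p) (ψ : S)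
    (h1 : ψ ∈ IsLocalRing.maximalIdeal S) (h2 : ψ ∉ (IsLocalRing.maximalIdeal S) ^ 2) :
    ∀ w : K, w ^ p ≠ (ψ : K) := by
  intro w hw
  have hp0 : 0 < p := by omega
  have hint : IsIntegral S w := by
    apply IsIntegral.of_pow hp0
    rw [hw]
    exact isIntegral_algebraMap (R := S) (x := ψ)
  have hwS : w ∈ S := hic w hint
  set y : S := ⟨w, hwS⟩ with hy
  have hyp : y ^ p = ψ := by
    apply Subtype.ext
    simp [hy, hw]
  have hym : y ∈ IsLocalRing.maximalIdeal S := by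
    by_contra hcontra
    have hyu : IsUnit y := by
      simpa [IsLocalRing.mem_maximalIdeal, mem_nonunits_iff] using hcontra
    have hψu : IsUnit ψ := by rw [← hyp]; exact hyu.pow p
    exact (IsLocalRing.mem_maximalIdeal _ |>.mp h1) hψu
  apply h2
  rw [← hyp]
  exact Ideal.pow_le_pow_right hp (Ideal.pow_mem_pow hym p)

/-- **EXIT LEMMA of THEOREM T.**  A finitely generated `A'' ⊇ A` inside `O` with `locAtCentre A''.toSubring O` regular, and a regular
parameter `ψ ∈ 𝔪 ∖ 𝔪²` of it written `ψ = Σ_{j<p} c_j^p g₀^j`, give `CleanLUConcl p k K O A g₀` in FORM (3) (`s := ψ`, `c′ := 0`); the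
representative is automatically non-trivial. [folklore] -/
theorem cleanLUConcl_of_parameter {p : ℕ} [Fact p.Prime] {k K : Type} [Field k] [Field K] [Algebra k K]
    (O : ValuationSubring K) (A A'' : Subalgebra k K) [IsFractionRing A K]
    (hA''O : A''.toSubring ≤ O.toSubring) (hAA'' : A ≤ A'') (hA''fg : A''.FG)
    (hreg : IsRegularLocalRing (locAtCentre A''.toSubring O)) (g₀ : K)
    (ψ : locAtCentre A''.toSubring O) (hψ1 : ψ ∈ IsLocalRing.maximalIdeal (locAtCentre A''.toSubring O))
    (hψ2 : ψ ∉ (IsLocalRing.maximalIdeal (locAtCentre A''.toSubring O)) ^ 2)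
    (c : Fin p → K) (hc : ∑ j : Fin p, c j ^ p * g₀ ^ (j : ℕ) = (ψ : K)) :
    CleanLUConcl p k K O A g₀ := by
  have hpp : p.Prime := Fact.out
  haveI : NeZero p := ⟨hpp.ne_zero⟩
  haveI := hreg
  -- `Frac (locAtCentre A'' O) = K` (it contains `A`)
  haveI : IsFractionRing (locAtCentre A''.toSubring O) K := by
    refine IsFractionRing.of_field _ _ (fun z => ?_)
    obtain ⟨a, b, hb, rfl⟩ := IsFractionRing.div_surjective (A := A) z
    have haR : (a : K) ∈ locAtCentre A''.toSubring O := le_locAtCentre _ O (hAA'' a.2)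
    have hbR : (b : K) ∈ locAtCentre A''.toSubring O := le_locAtCentre _ O (hAA'' b.2)
    exact ⟨⟨a, haR⟩, ⟨b, hbR⟩, rfl⟩
  have hicIn := isIntegrallyClosedIn_of_isRegularLocalRing (locAtCentre A''.toSubring O)
  have hic : ∀ w : K, IsIntegral (locAtCentre A''.toSubring O) w → w ∈ locAtCentre A''.toSubring O := by
    intro w hw
    obtain ⟨y, hy⟩ := (IsIntegrallyClosedIn.isIntegral_iff (R := locAtCentre A''.toSubring O) (A := K)).mp hw
    rw [← hy]
    exact y.2
  -- non-triviality of the representative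
  have hnt : ∃ j : Fin p, (j : ℕ) ≠ 0 ∧ c j ≠ 0 := by
    by_contra hall
    push Not at hall
    have hsum : ∑ j : Fin p, c j ^ p * g₀ ^ (j : ℕ) = c 0 ^ p := by
      rw [Finset.sum_eq_single (0 : Fin p)]
      · simp
      · intro j _ hj
        have hj' : (j : ℕ) ≠ 0 := fun h => hj (Fin.ext (by simpa using h))
        rw [hall j hj', zero_pow hpp.ne_zero, zero_mul]
      · intro h; exact absurd (Finset.mem_univ _) h
    exact pow_ne_of_mem_maximalIdeal_of_not_mem_sq' (locAtCentre A''.toSubring O) hic hpp.two_le ψ hψ1 hψ2 (c 0)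
      (by rw [← hsum, hc])
  refine ⟨A'', hA''O, hAA'', hA''fg, hreg, c, hnt, Or.inr (Or.inr ⟨ψ, 0, hc, ?_, ?_⟩)⟩
  · simpa [zero_pow hpp.ne_zero] using hψ1
  · simpa [zero_pow hpp.ne_zero] using hψ2

end Summit.ResolutionOfSingularities.ResolutionOfSingularities.Theorems.RadicialJung.CleanModels.Lens5.PRankTwoCurrency
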